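import Literature.LinearAlgebra.Matrix.IntegralUnitaryConjugacyOfRegularElements
import Literature.NumberTheory.LocalFields.UnramifiedQuadraticNormSemilocal
import Literature.AlgebraicGeometry.Resolution.FiniteOverCompleteLocal
import Mathlib.LinearAlgebra.Matrix.Charpoly.Coeff
import Mathlib.RingTheory.Polynomial.Basic
import Mathlib.RingTheory.PrincipalIdealDomain
import Mathlib.RingTheory.Nilpotent.Lemmas
import Mathlib.RingTheory.Ideal.Quotient.Nilpotent
import Mathlib.Algebra.Squarefree.Basic
import HarnessLib

/-!
# Integral unitary conjugacy over a COMPLETE local ring with finite residue field: the norm equation on the commutant order is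
# solvable, so Kottwitz's orbit lemma holds for the unramified unitary group with its hyperspecial subgroup
(Kottwitz, *Stable trace formula: elliptic singular terms* (1986), Prop. 7.1, Cor. 7.3; Rogawski (1990), §3.3 p. 21; Serre, *Local Fields*,
Ch. V §2)

Topic `LinearAlgebra/Matrix`; namespace `Literature.LinearAlgebra.Matrix`; THEOREMS ONLY (no definition, no instance, no named fact, no
`sorry`).  Inputs: ★ F1 `IntegralConjugacyOfRegularElements` (the integral commutant of `γ` is `𝒪[γ]`), ★ F2-b
`IntegralUnitaryConjugacyOfRegularElements` (the unitary upgrade MODULO the hypothesis `hnorm`), ★ F2-a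
`UnramifiedQuadraticNorm.exists_mul_map_eq_of_isReduced_quotient` (norm surjectivity over a complete SEMILOCAL ring with finite reduced
residue ring), ★ `Resolution.isAdicComplete_map_of_finite` (Matsumura 8.7).

THE DISCHARGE (§2, `hnorm_of_isAdicComplete`).  `𝒪` local Noetherian, complete for `𝔪`, residue field `k` finite; `σ` an involution of
`𝒪` with `σ a − a ∈ 𝒪ˣ` for some `a` (the integers of an UNRAMIFIED quadratic extension of local fields); `J` `σ`-hermitian invertible;
`γ ∈ M_m(𝒪)` `J`-unitary with `p_γ` separable modulo `𝔪`.  The commutant order `B = 𝒪[γ] = Algebra.adjoin 𝒪 {γ}` IS the commutant of `γ`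
(★ F1), a commutative module-finite `𝒪`-algebra, hence complete for `𝔪B` (Matsumura); the adjoint `τ = Ad(J⁻¹) ∘ ᵗσ` restricts to a ring
involution of `B` (it preserves the commutant of the unitary `γ`, ★ `commute_hermAdjoint_of_commute`) moving `a · 1` by a unit; and
`B ⧸ 𝔪B` is FINITE (the residues `Σ_{i<m} c̄_i γ^i`) and REDUCED (a quotient `k[X]⧸(g)` with `g ∣ p̄_γ` squarefree).  So ★ F2-a applies:
every `τ`-fixed unit of `B` is a norm `τ(c) c` — which is `hnorm`.

* §1 the commutant order: `mem_adjoin_iff_commute` (★ F1), `hermAdjoint_mem_adjoin`, `finite_quotient_adjoin` , `isReduced_quotient_adjoin`.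
* §2 **`hnorm_of_isAdicComplete`**.
* §3 hypothesis-free forms of ★ F2-b: **`exists_integral_unitary_conj_of_charpoly_eq_of_isAdicComplete`** (two `J`-unitary integral
  regular elements with the same characteristic polynomial, separable mod `𝔪`, are conjugate under `K = U(J)(𝒪)`) and
  **`exists_integral_unitary_map_mul_of_conj_of_isAdicComplete`** (`y (γ ⊗ 1) y⁻¹` integral, `y` unitary ⇒ `y ∈ K · U(J)(F)_γ`) — Kottwitz's
  Prop. 7.1 ∕ Cor. 7.3 for the unramified unitary group `U(J)` and its hyperspecial subgroup, over the valuation ring of the quadratic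
  unramified extension `E_w ⊃ F_v`.

What is NOT here: the `E_w ∕ 𝒪_w`-dress on ★ `unitaryGroupOfForm` ∕ ★ `glInt` and the CM a.e. assembly (consumer:
`NumberTheory/Automorphic/UnramifiedOrbitSetNonsplit`, hypothesis `hlocal`).

## References
* R. E. Kottwitz, *Stable trace formula: elliptic singular terms*, Math. Ann. 275 (1986), §7 Prop. 7.1, Cor. 7.3 [Kottwitz1986].
* J. D. Rogawski, *Automorphic Representations of Unitary Groups in Three Variables*, Ann. of Math. Stud. 123 (1990), §3.3 p. 21
  [Rogawski1990].
* J.-P. Serre, *Local Fields*, GTM 67 (1979), Ch. V §2 Prop. 3 and Corollary [Serre1979].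
-/

set_option autoImplicit false

open Matrix Polynomial
open scoped IsMulCommutative

namespace Literature.LinearAlgebra.Matrix

open Literature.NumberTheory.LocalFields.UnramifiedQuadraticNorm Literature.AlgebraicGeometry.Resolution

universe u

/-! ## §1 The commutant order `B = 𝒪[γ]` -/

section Commutant

variable {𝒪 : Type u} [CommRing 𝒪] [IsLocalRing 𝒪] {m : ℕ}

/-- **The integral commutant of `γ` is `𝒪[γ]`** (★ F1, membership form): for `p_γ` separable modulo `𝔪`, `X ∈ Algebra.adjoin 𝒪 {γ}` iff
`X` commutes with `γ`. [cite: Kottwitz1986, §7 Prop. 7.1] -/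
theorem mem_adjoin_iff_commute {γ : Matrix (Fin m) (Fin m) 𝒪} (hsep : (γ.charpoly.map (IsLocalRing.residue 𝒪)).Separable)
    (X : Matrix (Fin m) (Fin m) 𝒪) : X ∈ Algebra.adjoin 𝒪 {γ} ↔ Commute γ X := by
  constructor
  · intro hX
    exact Algebra.commute_of_mem_adjoin_self hX
  · intro hX
    obtain ⟨p, -, rfl⟩ := exists_eq_aeval_of_commute_of_separable γ hsep X hX
    exact Polynomial.aeval_mem_adjoin_singleton 𝒪 γ

variable (σ : 𝒪 →+* 𝒪)

/-- The adjoint `τ(b) = J⁻¹ ᵗ(σb) J` of a `J`-unitary `γ` maps `𝒪[γ]` into itself (`p_γ` separable mod `𝔪`).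
[cite: Kottwitz1986, §7 Prop. 7.1] -/
theorem hermAdjoint_mem_adjoin {J γ : Matrix (Fin m) (Fin m) 𝒪} (hJdet : IsUnit J.det) (hγU : (γ.map σ)ᵀ * J * γ = J)
    (hsep : (γ.charpoly.map (IsLocalRing.residue 𝒪)).Separable) {b : Matrix (Fin m) (Fin m) 𝒪} (hb : b ∈ Algebra.adjoin 𝒪 {γ}) :
    J⁻¹ * (b.map σ)ᵀ * J ∈ Algebra.adjoin 𝒪 {γ} :=
  (mem_adjoin_iff_commute hsep _).2 (commute_hermAdjoint_of_commute σ hJdet hγU ((mem_adjoin_iff_commute hsep b).1 hb))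

omit [IsLocalRing 𝒪] in
/-- Polynomials in `γ` computed inside the subalgebra `𝒪[γ]` are the polynomials in `γ`. [cite: Kottwitz1986, §7 Prop. 7.1] -/
theorem coe_aeval_adjoin {γ : Matrix (Fin m) (Fin m) 𝒪} (γB : ↥(Algebra.adjoin 𝒪 ({γ} : Set (Matrix (Fin m) (Fin m) 𝒪))))
    (hγB : (γB : Matrix (Fin m) (Fin m) 𝒪) = γ) (p : 𝒪[X]) : ((aeval γB p : ↥(Algebra.adjoin 𝒪 {γ})) : Matrix (Fin m) (Fin m) 𝒪) = aeval γ p := by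
  have h := (Polynomial.aeval_algHom_apply (Algebra.adjoin 𝒪 ({γ} : Set (Matrix (Fin m) (Fin m) 𝒪))).val γB p).symm
  rw [Subalgebra.coe_val] at h
  rw [hγB] at h
  exact h

/-- Elements of `𝒪[γ]` are `Σ_{i<m} c_i γ^i` (★ F1 degree bound); hence **`𝒪[γ] ⧸ 𝔪·𝒪[γ]` is finite** when the residue field is:
the residues are the `Σ_{i<m} c̄_i γ^i`. [cite: Kottwitz1986, §7 Prop. 7.1] -/
theorem finite_quotient_adjoin [Finite (IsLocalRing.ResidueField 𝒪)] {γ : Matrix (Fin m) (Fin m) 𝒪}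
    (hsep : (γ.charpoly.map (IsLocalRing.residue 𝒪)).Separable) :
    Finite (↥(Algebra.adjoin 𝒪 {γ}) ⧸
      (IsLocalRing.maximalIdeal 𝒪).map (algebraMap 𝒪 ↥(Algebra.adjoin 𝒪 {γ}))) := by
  classical
  set B := Algebra.adjoin 𝒪 ({γ} : Set (Matrix (Fin m) (Fin m) 𝒪)) with hB
  set I : Ideal ↥B := (IsLocalRing.maximalIdeal 𝒪).map (algebraMap 𝒪 ↥B) with hI
  obtain ⟨γB, hγB⟩ : ∃ γB : ↥B, (γB : Matrix (Fin m) (Fin m) 𝒪) = γ := ⟨⟨γ, Algebra.self_mem_adjoin_singleton 𝒪 γ⟩, rfl⟩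
  -- a section of the residue map
  have hres : Function.Surjective (IsLocalRing.residue 𝒪) := Ideal.Quotient.mk_surjective
  obtain ⟨sec, hsec⟩ : ∃ sec : IsLocalRing.ResidueField 𝒪 → 𝒪, ∀ r, IsLocalRing.residue 𝒪 (sec r) = r :=
    ⟨Function.surjInv hres, Function.surjInv_eq hres⟩
  let ψ : (Fin m → IsLocalRing.ResidueField 𝒪) → ↥B ⧸ I := fun r =>
    Ideal.Quotient.mk I (∑ i : Fin m, algebraMap 𝒪 ↥B (sec (r i)) * γB ^ (i : ℕ))
  refine Finite.of_surjective ψ fun q => ?_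
  obtain ⟨b, rfl⟩ := Ideal.Quotient.mk_surjective q
  obtain ⟨p, hp, hb⟩ := exists_eq_aeval_of_commute_of_separable γ hsep b.1 ((mem_adjoin_iff_commute hsep b.1).1 b.2)
  refine ⟨fun i => IsLocalRing.residue 𝒪 (p.coeff i), ?_⟩
  -- `b = Σ_{i<m} (coeff p i) γ^i` in `B`
  have hbsum : b = ∑ i : Fin m, algebraMap 𝒪 ↥B (p.coeff i) * γB ^ (i : ℕ) := by
    apply Subtype.ext
    change (b : Matrix (Fin m) (Fin m) 𝒪) = B.val (∑ i : Fin m, algebraMap 𝒪 ↥B (p.coeff i) * γB ^ (i : ℕ))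
    rw [map_sum]
    simp only [map_mul, map_pow, AlgHom.commutes, Subalgebra.coe_val, hγB, hb]
    by_cases hp0 : p = 0
    · simp [hp0]
    · have hnat : p.natDegree < m := (Polynomial.natDegree_lt_iff_degree_lt hp0).2 hp
      rw [Polynomial.aeval_eq_sum_range' hnat, Finset.sum_range]
      simp only [Algebra.smul_def]
  change Ideal.Quotient.mk I _ = Ideal.Quotient.mk I b
  rw [Ideal.Quotient.eq, hbsum, ← Finset.sum_sub_distrib]
  refine I.sum_mem fun i _ => ?_
  rw [← sub_mul, ← map_sub]
  refine I.mul_mem_right _ (Ideal.mem_map_of_mem _ ?_)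
  rw [← IsLocalRing.residue_eq_zero_iff, map_sub, hsec, sub_self]

/-- **`𝒪[γ] ⧸ 𝔪·𝒪[γ]` is reduced**: it is a quotient of `k[X]` by an ideal `(g)` with `g ∣ p̄_γ`, and `p̄_γ` is separable, so `g` is
squarefree and `(g)` is radical. [cite: Kottwitz1986, §7 Prop. 7.1] -/
theorem isReduced_quotient_adjoin {γ : Matrix (Fin m) (Fin m) 𝒪} (hsep : (γ.charpoly.map (IsLocalRing.residue 𝒪)).Separable) :
    IsReduced (↥(Algebra.adjoin 𝒪 {γ}) ⧸
      (IsLocalRing.maximalIdeal 𝒪).map (algebraMap 𝒪 ↥(Algebra.adjoin 𝒪 {γ}))) := by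
  classical
  set B := Algebra.adjoin 𝒪 ({γ} : Set (Matrix (Fin m) (Fin m) 𝒪)) with hB
  set I : Ideal ↥B := (IsLocalRing.maximalIdeal 𝒪).map (algebraMap 𝒪 ↥B) with hI
  obtain ⟨γB, hγB⟩ : ∃ γB : ↥B, (γB : Matrix (Fin m) (Fin m) 𝒪) = γ := ⟨⟨γ, Algebra.self_mem_adjoin_singleton 𝒪 γ⟩, rfl⟩
  -- `Φ : 𝒪[X] → B ⧸ I`, `p ↦ p(γ) mod 𝔪B`, surjective
  let Φ : 𝒪[X] →+* ↥B ⧸ I := (Ideal.Quotient.mk I).comp (Polynomial.aeval γB).toRingHom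
  have hΦ : ∀ p : 𝒪[X], Φ p = Ideal.Quotient.mk I (aeval γB p) := fun p => rfl
  have hΦsurj : Function.Surjective Φ := by
    intro q
    obtain ⟨b, rfl⟩ := Ideal.Quotient.mk_surjective q
    obtain ⟨p, -, hb⟩ := exists_eq_aeval_of_commute_of_separable γ hsep b.1 ((mem_adjoin_iff_commute hsep b.1).1 b.2)
    refine ⟨p, ?_⟩
    rw [hΦ]
    congr 1
    apply Subtype.ext
    rw [coe_aeval_adjoin γB hγB, ← hb]
  -- `Φ` kills `𝔪[X] = ker (𝒪[X] → k[X])`, so it factors through `k[X]`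
  set res : 𝒪 →+* IsLocalRing.ResidueField 𝒪 := IsLocalRing.residue 𝒪 with hres_def
  have hres : Function.Surjective res := Ideal.Quotient.mk_surjective
  have hresX : Function.Surjective (Polynomial.mapRingHom res) := Polynomial.map_surjective res hres
  have hker : RingHom.ker (Polynomial.mapRingHom res) ≤ RingHom.ker Φ := by
    rw [Polynomial.ker_mapRingHom, Ideal.map_le_iff_le_comap]
    intro c hc
    have hc' : c ∈ IsLocalRing.maximalIdeal 𝒪 := (IsLocalRing.residue_eq_zero_iff c).1 (RingHom.mem_ker.1 hc)
    rw [Ideal.mem_comap, RingHom.mem_ker, hΦ, Polynomial.aeval_C, Ideal.Quotient.eq_zero_iff_mem]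
    exact Ideal.mem_map_of_mem _ hc'
  set Φk : (IsLocalRing.ResidueField 𝒪)[X] →+* ↥B ⧸ I := (Polynomial.mapRingHom res).liftOfSurjective hresX ⟨Φ, hker⟩ with hΦk_def
  have hΦk : ∀ p : 𝒪[X], Φk (p.map res) = Φ p := fun p =>
    (Polynomial.mapRingHom res).liftOfRightInverse_comp_apply _ _ ⟨Φ, hker⟩ p
  have hΦksurj : Function.Surjective Φk := by
    intro q
    obtain ⟨p, rfl⟩ := hΦsurj q
    exact ⟨p.map res, hΦk p⟩
  -- `p̄_γ ∈ ker Φk` (Cayley–Hamilton)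
  have hχ : γ.charpoly.map res ∈ RingHom.ker Φk := by
    rw [RingHom.mem_ker, hΦk, hΦ, Ideal.Quotient.eq_zero_iff_mem]
    have h0 : aeval γB γ.charpoly = 0 := by
      apply Subtype.ext
      rw [coe_aeval_adjoin γB hγB, Matrix.aeval_self_charpoly]
      rfl
    rw [h0]
    exact I.zero_mem
  -- `ker Φk = (g)` with `g ∣ p̄_γ` squarefree, hence radical
  set K : Ideal (IsLocalRing.ResidueField 𝒪)[X] := RingHom.ker Φk with hK_def
  haveI : K.IsPrincipal := IsPrincipalIdealRing.principal K
  have hK : K = Ideal.span {Submodule.IsPrincipal.generator K} := (Ideal.span_singleton_generator K).symm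
  have hg : Submodule.IsPrincipal.generator K ∣ γ.charpoly.map res := by
    rw [← Ideal.mem_span_singleton, ← hK]
    exact hχ
  have hsq : Squarefree (Submodule.IsPrincipal.generator K) := Squarefree.squarefree_of_dvd hg hsep.squarefree
  have hKrad : K.IsRadical := by
    rw [hK]
    exact (isRadical_iff_span_singleton).1 hsq.isRadical
  haveI : IsReduced ((IsLocalRing.ResidueField 𝒪)[X] ⧸ K) := (Ideal.isRadical_iff_quotient_reduced K).1 hKrad
  -- transport along `k[X] ⧸ ker Φk ≃ B ⧸ I`
  exact isReduced_of_injective (RingHom.quotientKerEquivOfSurjective hΦksurj).symm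
    (RingHom.quotientKerEquivOfSurjective hΦksurj).symm.injective

end Commutant

/-! ## §2 The discharge of `hnorm`: every `τ`-fixed unit of the commutant is a norm from the commutant -/

section Discharge

variable {𝒪 : Type u} [CommRing 𝒪] [IsLocalRing 𝒪] [IsNoetherianRing 𝒪] [IsAdicComplete (IsLocalRing.maximalIdeal 𝒪) 𝒪]
  [Finite (IsLocalRing.ResidueField 𝒪)] (σ : 𝒪 →+* 𝒪) {m : ℕ}

/-- **Norm surjectivity on the commutant order** — the discharge of the hypothesis `hnorm` of ★
`exists_integral_unitary_conj_of_conj`.  `𝒪` local Noetherian, `𝔪`-adically complete, finite residue field; `σ` an involution with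
`σ a − a ∈ 𝒪ˣ` for some `a`; `J` `σ`-hermitian invertible; `γ ∈ M_m(𝒪)` `J`-unitary with `p_γ` separable modulo `𝔪`.  Then every
invertible `b` commuting with `γ` and fixed by the adjoint `τ(X) = J⁻¹ ᵗ(σX) J` is `τ(c) c` for some `c` commuting with `γ`.  (The
commutant is the commutative order `B = 𝒪[γ]`, complete for `𝔪B`, with `B ⧸ 𝔪B` finite reduced; `τ|_B` is a ring involution moving
`a·1` by a unit; ★ `exists_mul_map_eq_of_isReduced_quotient`.) [cite: Kottwitz1986, §7 Prop. 7.1] [cite: Serre1979, Ch. V §2 Prop. 3 and Corollary] -/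
theorem hnorm_of_isAdicComplete (hσ : ∀ a, σ (σ a) = a) {a : 𝒪} (ha : IsUnit (σ a - a)) {J : Matrix (Fin m) (Fin m) 𝒪}
    (hJ : (J.map σ)ᵀ = J) (hJdet : IsUnit J.det) {γ : Matrix (Fin m) (Fin m) 𝒪} (hγU : (γ.map σ)ᵀ * J * γ = J)
    (hsep : (γ.charpoly.map (IsLocalRing.residue 𝒪)).Separable) (b : Matrix (Fin m) (Fin m) 𝒪) (hbγ : Commute γ b)
    (hb : IsUnit b.det) (hτb : J⁻¹ * (b.map σ)ᵀ * J = b) :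
    ∃ c : Matrix (Fin m) (Fin m) 𝒪, Commute γ c ∧ J⁻¹ * (c.map σ)ᵀ * J * c = b := by
  classical
  set B := Algebra.adjoin 𝒪 ({γ} : Set (Matrix (Fin m) (Fin m) 𝒪)) with hB
  set I : Ideal ↥B := (IsLocalRing.maximalIdeal 𝒪).map (algebraMap 𝒪 ↥B) with hI
  -- `B` is module-finite over the Noetherian `𝒪`, hence `𝔪B`-adically complete; `B ⧸ 𝔪B` is finite and reduced
  haveI : Module.Finite 𝒪 ↥B := Module.Finite.of_injective B.val.toLinearMap Subtype.val_injective
  haveI : IsAdicComplete I ↥B := isAdicComplete_map_of_finite 𝒪 (↥B) (IsLocalRing.maximalIdeal 𝒪)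
  haveI : Finite (↥B ⧸ I) := finite_quotient_adjoin hsep
  haveI : IsReduced (↥B ⧸ I) := isReduced_quotient_adjoin hsep
  -- the adjoint restricted to `B`, a ring involution
  have hmem : ∀ x : ↥B, J⁻¹ * ((x : Matrix (Fin m) (Fin m) 𝒪).map σ)ᵀ * J ∈ B := fun x =>
    hermAdjoint_mem_adjoin σ hJdet hγU hsep x.2
  let τB : ↥B →+* ↥B :=
    { toFun := fun x => ⟨J⁻¹ * ((x : Matrix (Fin m) (Fin m) 𝒪).map σ)ᵀ * J, hmem x⟩
      map_one' := Subtype.ext (by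
        change J⁻¹ * ((1 : Matrix (Fin m) (Fin m) 𝒪).map σ)ᵀ * J = 1
        exact hermAdjoint_one σ hJdet)
      map_mul' := fun x y => by
        have hc : (⟨_, hmem x⟩ * ⟨_, hmem y⟩ : ↥B) = ⟨_, hmem y⟩ * ⟨_, hmem x⟩ := mul_comm' _ _
        apply Subtype.ext
        change J⁻¹ * (((x : Matrix (Fin m) (Fin m) 𝒪) * y).map σ)ᵀ * J =
          (J⁻¹ * ((x : Matrix (Fin m) (Fin m) 𝒪).map σ)ᵀ * J) * (J⁻¹ * ((y : Matrix (Fin m) (Fin m) 𝒪).map σ)ᵀ * J)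
        rw [hermAdjoint_mul σ hJdet]
        exact (congrArg Subtype.val hc).symm
      map_zero' := Subtype.ext (by
        change J⁻¹ * ((0 : Matrix (Fin m) (Fin m) 𝒪).map σ)ᵀ * J = 0
        rw [Matrix.map_zero σ (map_zero σ), Matrix.transpose_zero, Matrix.mul_zero, Matrix.zero_mul])
      map_add' := fun x y => Subtype.ext (by
        change J⁻¹ * (((x : Matrix (Fin m) (Fin m) 𝒪) + y).map σ)ᵀ * J =
          J⁻¹ * ((x : Matrix (Fin m) (Fin m) 𝒪).map σ)ᵀ * J + J⁻¹ * ((y : Matrix (Fin m) (Fin m) 𝒪).map σ)ᵀ * J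
        exact hermAdjoint_add σ J _ _) }
  have hτB_coe : ∀ x : ↥B, ((τB x : ↥B) : Matrix (Fin m) (Fin m) 𝒪) = J⁻¹ * ((x : Matrix (Fin m) (Fin m) 𝒪).map σ)ᵀ * J :=
    fun _ => rfl
  have hτB : ∀ x, τB (τB x) = x := fun x =>
    Subtype.ext (by rw [hτB_coe, hτB_coe]; exact hermAdjoint_hermAdjoint σ hσ hJ hJdet _)
  -- `τB ∘ algebraMap = algebraMap ∘ σ`
  have hcomp : τB.comp (algebraMap 𝒪 ↥B) = (algebraMap 𝒪 ↥B).comp σ := by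
    refine RingHom.ext fun c => Subtype.ext ?_
    rw [RingHom.comp_apply, RingHom.comp_apply, hτB_coe, Subalgebra.coe_algebraMap, Subalgebra.coe_algebraMap,
      Algebra.algebraMap_eq_smul_one, Algebra.algebraMap_eq_smul_one, hermAdjoint_smul, hermAdjoint_one σ hJdet]
  have hτBI : ∀ x ∈ I, τB x ∈ I := by
    have hle : I.map τB ≤ I := by
      rw [hI, Ideal.map_map, hcomp, ← Ideal.map_map]
      exact Ideal.map_mono (Ideal.map_le_iff_le_comap.2 fun c hc => map_mem_maximalIdeal σ hσ c hc)
    exact fun x hx => hle (Ideal.mem_map_of_mem τB hx)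
  have ha' : IsUnit (τB (algebraMap 𝒪 ↥B a) - algebraMap 𝒪 ↥B a) := by
    rw [← RingHom.comp_apply, hcomp, RingHom.comp_apply, ← map_sub]
    exact ha.map _
  -- `b` as a `τB`-fixed unit of `B`
  let bB : ↥B := ⟨b, (mem_adjoin_iff_commute hsep b).2 hbγ⟩
  have hbinv : b⁻¹ ∈ B :=
    (mem_adjoin_iff_commute hsep _).2 (nonsing_inv_mul_eq_mul_nonsing_inv_of_commute hb hbγ).symm
  have hbU : IsUnit bB := IsUnit.of_mul_eq_one ⟨b⁻¹, hbinv⟩ (Subtype.ext (Matrix.mul_nonsing_inv b hb))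
  have hτbB : τB bB = bB := Subtype.ext hτb
  obtain ⟨s, hs⟩ := exists_mul_map_eq_of_isReduced_quotient τB hτB hτBI ha' bB hbU hτbB
  refine ⟨s, (mem_adjoin_iff_commute hsep _).1 s.2, ?_⟩
  have h := congrArg Subtype.val ((mul_comm' (τB s) s).trans hs)
  exact h

end Discharge

/-! ## §3 Kottwitz's lemma for the unramified unitary group, hypothesis-free over a complete local ring -/

section Final

variable {𝒪 : Type u} [CommRing 𝒪] [IsLocalRing 𝒪] [IsNoetherianRing 𝒪] [IsAdicComplete (IsLocalRing.maximalIdeal 𝒪) 𝒪]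
  [Finite (IsLocalRing.ResidueField 𝒪)] (σ : 𝒪 →+* 𝒪) {m : ℕ}

/-- **Integral points of the unramified unitary group with the same regular characteristic polynomial are `K`-conjugate**
(Kottwitz's Prop. 7.1 for `U(J)`, two integral points; hypothesis-free): `𝒪` local Noetherian complete with finite residue field, `σ`
an involution moving some element by a unit, `J` `σ`-hermitian invertible; two `J`-unitary `γ, δ ∈ M_m(𝒪)` with `p_δ = p_γ` separable
modulo `𝔪` satisfy `δ k = k γ` for some `J`-UNITARY `k ∈ GL_m(𝒪)`. [cite: Kottwitz1986, §7 Prop. 7.1] [cite: Rogawski1990, §3.3 p. 21] -/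
theorem exists_integral_unitary_conj_of_charpoly_eq_of_isAdicComplete (hσ : ∀ a, σ (σ a) = a) {a : 𝒪}
    (ha : IsUnit (σ a - a)) {J : Matrix (Fin m) (Fin m) 𝒪} (hJ : (J.map σ)ᵀ = J) (hJdet : IsUnit J.det)
    {γ δ : Matrix (Fin m) (Fin m) 𝒪} (hsep : (γ.charpoly.map (IsLocalRing.residue 𝒪)).Separable)
    (hchar : δ.charpoly = γ.charpoly) (hγU : (γ.map σ)ᵀ * J * γ = J) (hδU : (δ.map σ)ᵀ * J * δ = J) :
    ∃ k : Matrix (Fin m) (Fin m) 𝒪, IsUnit k.det ∧ (k.map σ)ᵀ * J * k = J ∧ δ * k = k * γ :=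
  exists_integral_unitary_conj_of_charpoly_eq σ hσ hJ hJdet hsep hchar hγU hδU
    (hnorm_of_isAdicComplete σ hσ ha hJ hJdet hγU hsep)

variable {F : Type*} [CommRing F]

/-- **Kottwitz's orbit lemma for the unramified unitary group with its hyperspecial subgroup** (Prop. 7.1 ∕ Cor. 7.3, hypothesis-free
over a complete local ring): `f : 𝒪 →+* F` injective intertwining the involutions `σ`, `σ_F` (`𝒪_w ↪ E_w`); `𝒪` local Noetherian
complete with finite residue field and `σ a − a ∈ 𝒪ˣ` for some `a` (unramified); `J ∈ GL_m(𝒪)` `σ`-hermitian; `γ ∈ M_m(𝒪)` `J`-unitary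
with `p_γ` separable mod `𝔪`; `y ∈ GL_m(F)` `(σ_F, J ⊗ 1)`-unitary with `y (γ ⊗ 1) = (g′ ⊗ 1) y`, `g′` integral.  Then `y = (k ⊗ 1) · z`
with `k ∈ GL_m(𝒪)` `J`-UNITARY and `z ∈ GL_m(F)` `J`-unitary commuting with `γ ⊗ 1`: «`{y ∈ G(F) ∣ y γ y⁻¹ ∈ K} = K · G_γ(F)`» for
`G = U(J)`, `K = G(F) ∩ GL_m(𝒪)`. [cite: Kottwitz1986, §7 Prop. 7.1, Cor. 7.3] [cite: Rogawski1990, §3.3 p. 21] -/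
theorem exists_integral_unitary_map_mul_of_conj_of_isAdicComplete (f : 𝒪 →+* F) (hf : Function.Injective f)
    {σF : F →+* F} (hfσ : ∀ x, f (σ x) = σF (f x)) (hσ : ∀ a, σ (σ a) = a) {a : 𝒪} (ha : IsUnit (σ a - a))
    {J : Matrix (Fin m) (Fin m) 𝒪} (hJ : (J.map σ)ᵀ = J) (hJdet : IsUnit J.det) {γ g' : Matrix (Fin m) (Fin m) 𝒪}
    (hγU : (γ.map σ)ᵀ * J * γ = J) (hsep : (γ.charpoly.map (IsLocalRing.residue 𝒪)).Separable)
    {y : Matrix (Fin m) (Fin m) F} (hy : IsUnit y.det) (hyU : (y.map σF)ᵀ * J.map f * y = J.map f)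
    (h : y * γ.map f = g'.map f * y) :
    ∃ (k : Matrix (Fin m) (Fin m) 𝒪) (z : Matrix (Fin m) (Fin m) F), IsUnit k.det ∧ (k.map σ)ᵀ * J * k = J ∧
      IsUnit z.det ∧ z * γ.map f = γ.map f * z ∧ (z.map σF)ᵀ * J.map f * z = J.map f ∧ y = k.map f * z :=
  exists_integral_unitary_map_mul_of_conj f hf hfσ hσ hJ hJdet hγU hsep
    (hnorm_of_isAdicComplete σ hσ ha hJ hJdet hγU hsep) hy hyU h

end Final

end Literature.LinearAlgebra.Matrix
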